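import Summits.CriticalPhenomena.PercolationContinuityZ3.Theorems.SahiMasterFamilyPCDAbstract

/-!
# The principal-cap dichotomy, II: the coatom lemma — a zero family contains every co-point

Support file of the master-family programme (crux `NoHeavyLowerTail`, stmt-CriticalPhenomena-4575; cell `prim-masterthm`, seat P4,
unit `prim-masterthm-p4-g6`).  Seat document HOME/prim-masterthm-p4/PROOF-PCD.md §1 (1b).  Pure finite combinatorics.

**`sdiff_singleton_mem_of_Z_eq_zero` (COATOM LEMMA).**  Let `Q` be a family of subsets of `X` closed under pairwise unions,
`X ∈ Q`, `|X| ≥ 2`, and suppose the signed partition sum vanishes, `Z_Q(𝟙; X) = 0` (i.e. `N_Q(𝟙) = 0`).  Then `X ∖ {x} ∈ Q` for EVERY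
`x ∈ X`.

Proof (PROOF-PCD (1b), with the quotient realised as a RE-WEIGHTING ON A SUBSET, no quotient type): suppose `M = X ∖ x ∉ Q`; let
`W` be the union of the members inside `M` (`W ≠ M`), `V = X ∖ W ∋ x` (`|V| = d + 1 ≥ 2`), `X̃ = W ∪ {x}`, and
`Q̃ = {C ∈ Q : C ⊆ W} ∪ {(T ∖ V) ∪ {x} : T ∈ Q, T ⊇ V}` (union-closed on `X̃`, `X̃ ∈ Q̃`).  In the block expansion of `Z_Q(X)` at `x`
(`Z_rec`) only blocks `T ⊇ V` survive (the complement of any other block is a non-member), and `T ↦ (T ∖ V) ∪ {x}` matches them with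
the blocks of the expansion of `Z_{Q̃}(X̃)` at `x`, with the same cofactors `a_T = N_Q(X ∖ T) ≥ 0` and weights `(|T|−1)!` resp.
`(|T|−d−1)!`.  So `Σ_T (|T|−1)! a_T = (k−1)!` (from `Z_Q(X) = 0`) while `Σ_T (|T|−d−1)! a_T ≤ (k−d−1)!` (from `Z_{Q̃}(X̃) ≤ 0`,
`SahiSparseEnd.Z_nonpos`), which the strict inequality `(|T|−1)!(k−d−1)! < (k−1)!(|T|−d−1)!` (`|T| < k`, `d ≥ 1`) forbids.
HONEST FRAMING: elementary; [this work].  Used by the KeyStep file; nothing here bears on `C_n` [Sahi2008, Conj. 5].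
-/

namespace Summit.CriticalPhenomena.PercolationContinuityZ3.Theorems

namespace SahiSparseEnd

open Finset Nat

variable {α : Type*} [DecidableEq α]

/-! ### A factorial comparison -/

omit [DecidableEq α] in
/-- `(a+1)(a+2)⋯(a+d) < (c+1)(c+2)⋯(c+d)` for `a < c`, `d ≥ 1`. [folklore] -/
theorem ascFactorial_succ_lt_of_lt {a c : ℕ} (hac : a < c) : ∀ {d : ℕ}, 1 ≤ d → (a + 1).ascFactorial d < (c + 1).ascFactorial d
  | 0, h => absurd h (by omega)
  | 1, _ => by rw [Nat.ascFactorial_succ, Nat.ascFactorial_succ, Nat.ascFactorial_zero, Nat.ascFactorial_zero]; omega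
  | d + 2, _ => by
    rw [Nat.ascFactorial_succ, Nat.ascFactorial_succ (n := c + 1)]
    have ih := ascFactorial_succ_lt_of_lt hac (d := d + 1) (by omega)
    have h0 : 0 < (a + 1).ascFactorial (d + 1) := Nat.ascFactorial_pos a (d + 1)
    nlinarith

omit [DecidableEq α] in
/-- **`(m−1)!·(k−d−1)! < (k−1)!·(m−d−1)!`** for `1 ≤ d`, `d + 1 ≤ m < k`. [folklore] -/
theorem factorial_mul_factorial_lt {m k d : ℕ} (hd : 1 ≤ d) (hdm : d + 1 ≤ m) (hmk : m < k) :
    (m - 1)! * (k - d - 1)! < (k - 1)! * (m - d - 1)! := by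
  obtain ⟨a, rfl⟩ : ∃ a, m = a + d + 1 := ⟨m - d - 1, by omega⟩
  obtain ⟨c, rfl⟩ : ∃ c, k = c + d + 1 := ⟨k - d - 1, by omega⟩
  have hac : a < c := by omega
  rw [show a + d + 1 - 1 = a + d by omega, show c + d + 1 - 1 = c + d by omega, show a + d + 1 - d - 1 = a by omega,
    show c + d + 1 - d - 1 = c by omega, ← Nat.factorial_mul_ascFactorial a d, ← Nat.factorial_mul_ascFactorial c d]
  have h := ascFactorial_succ_lt_of_lt hac hd
  have ha := Nat.factorial_pos a
  have hc := Nat.factorial_pos c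
  calc a ! * (a + 1).ascFactorial d * c ! = (a ! * c !) * (a + 1).ascFactorial d := by ring
    _ < (a ! * c !) * (c + 1).ascFactorial d := Nat.mul_lt_mul_of_pos_left h (Nat.mul_pos ha hc)
    _ = c ! * (c + 1).ascFactorial d * a ! := by ring

/-! ### The block expansion with the top block split off -/

/-- `Z_Q(X) = −(b_X − 1)! + Σ_{x ∈ T ∈ Q, T ⊊ X} (−(b_T−1)!)·Z_Q(X ∖ T)` for `x ∈ X ∈ Q`. [this work] -/
theorem Z_rec_split (Q : Finset (Finset α)) (b : α → ℕ) {X : Finset α} {x : α} (hx : x ∈ X) (hXQ : X ∈ Q) :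
    Z Q b X = -bw b X + ∑ T ∈ (X.powerset.filter fun T => x ∈ T ∧ T ∈ Q).erase X, (-bw b T) * Z Q b (X \ T) := by
  have hXmem : X ∈ X.powerset.filter fun T => x ∈ T ∧ T ∈ Q := mem_filter.2 ⟨mem_powerset.2 subset_rfl, hx, hXQ⟩
  rw [Z_rec Q b hx, ← add_sum_erase _ _ hXmem, Finset.sdiff_self, Z_empty, mul_one]

/-! ### The coatom lemma -/

/-- **COATOM LEMMA (PROOF-PCD (1b)).**  For a family `Q` of subsets of `X` closed under pairwise unions with `X ∈ Q`,
`|X| ≥ 2` and `Z_Q(𝟙; X) = 0`: every co-point `X ∖ {x}` (`x ∈ X`) belongs to `Q`. [this work] -/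
theorem sdiff_singleton_mem_of_Z_eq_zero {Q : Finset (Finset α)} {X : Finset α} (hQ : ∀ A ∈ Q, ∀ B ∈ Q, A ∪ B ∈ Q)
    (hQX : Q ⊆ X.powerset) (hXQ : X ∈ Q) (hcard : 2 ≤ X.card)
    (hZ : Z Q (fun _ => 1) X = 0) {x : α} (hx : x ∈ X) : X \ {x} ∈ Q := by
  by_contra hM
  -- `W` = the union of the members inside `M = X ∖ x`
  set W := (Q.filter fun C => C ⊆ X \ {x}).biUnion id with hWdef
  have hWM : W ⊆ X \ {x} := biUnion_subset.2 fun C hC => by rw [mem_filter] at hC; exact hC.2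
  have hCW : ∀ C ∈ Q, C ⊆ X \ {x} → C ⊆ W := fun C hC hCM => subset_biUnion_of_mem id (mem_filter.2 ⟨hC, hCM⟩)
  have hWX : W ⊆ X := hWM.trans sdiff_subset
  have hxW : x ∉ W := fun h => by have := mem_sdiff.1 (hWM h); exact this.2 (mem_singleton_self x)
  have hWneM : W ≠ X \ {x} := by
    intro hWM'
    rcases (Q.filter fun C => C ⊆ X \ {x}).eq_empty_or_nonempty with he | hne
    · have hW0 : W = ∅ := by rw [hWdef, he, biUnion_empty]
      have h1 : (X \ {x}).card = X.card - 1 := by rw [card_sdiff_of_subset (singleton_subset_iff.2 hx), card_singleton]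
      rw [← hWM', hW0, card_empty] at h1
      omega
    · exact hM (hWM' ▸ biUnion_mem_of_unionClosed hQ _ (filter_subset _ _) hne)
  -- `V = X ∖ W ∋ x`, `|V| ≥ 2`
  set V := X \ W with hVdef
  have hxV : x ∈ V := mem_sdiff.2 ⟨hx, hxW⟩
  have hVX : V ⊆ X := sdiff_subset
  have hWV : Disjoint W V := disjoint_sdiff
  have hXWV : X = W ∪ V := by rw [hVdef, union_sdiff_of_subset hWX]
  have hV2 : 2 ≤ V.card := by
    obtain ⟨y, hy⟩ : ((X \ {x}) \ W).Nonempty := sdiff_nonempty.2 fun h => hWneM (subset_antisymm hWM h)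
    rw [mem_sdiff, mem_sdiff, mem_singleton] at hy
    have hyV : y ∈ V := mem_sdiff.2 ⟨hy.1.1, hy.2⟩
    have hxy : x ≠ y := fun e => hy.1.2 e.symm
    calc 2 = ({x, y} : Finset α).card := (card_pair hxy).symm
      _ ≤ V.card := card_le_card (insert_subset hxV (singleton_subset_iff.2 hyV))
  have hXcard : X.card = W.card + V.card := by rw [hXWV, card_union_of_disjoint hWV]
  -- the re-weighted family `Q̃` on `X̃ = W ∪ {x}`
  set Xt := insert x W with hXtdef
  have hXtcard : Xt.card = W.card + 1 := card_insert_of_notMem hxW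
  set φ : Finset α → Finset α := fun T => insert x (T \ V) with hφdef
  set Qt := (Q.filter fun C => C ⊆ W) ∪ ((Q.filter fun T => V ⊆ T).image φ) with hQtdef
  have hTVW : ∀ T ∈ Q, T \ V ⊆ W := by
    intro T hT y hy
    rw [mem_sdiff] at hy
    have hyX : y ∈ X := mem_powerset.1 (hQX hT) hy.1
    by_contra hyW
    exact hy.2 (mem_sdiff.2 ⟨hyX, hyW⟩)
  have hφXt : ∀ T ∈ Q, φ T ⊆ Xt := fun T hT => insert_subset_insert x (hTVW T hT)
  have mem_Qt : ∀ A, A ∈ Qt ↔ (A ∈ Q ∧ A ⊆ W) ∨ ∃ T ∈ Q, V ⊆ T ∧ φ T = A := by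
    intro A
    rw [hQtdef, mem_union, mem_filter, mem_image]
    simp only [mem_filter, and_assoc]
  have hQtX : Qt ⊆ Xt.powerset := by
    intro A hA
    rw [mem_powerset]
    rcases (mem_Qt A).1 hA with ⟨-, hAW⟩ | ⟨T, hT, -, rfl⟩
    · exact hAW.trans (subset_insert _ _)
    · exact hφXt T hT
  -- unions: `C ∪ φ T = φ (C ∪ T)` and `φ T ∪ φ T' = φ (T ∪ T')`
  have hφC : ∀ C, C ⊆ W → ∀ T, C ∪ φ T = φ (C ∪ T) := by
    intro C hCW T
    rw [hφdef]
    dsimp only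
    rw [union_insert, union_sdiff_distrib, sdiff_eq_self_of_disjoint (hWV.mono_left hCW)]
  have hφφ : ∀ T T', φ T ∪ φ T' = φ (T ∪ T') := by
    intro T T'
    rw [hφdef]
    dsimp only
    rw [← insert_union_distrib, union_sdiff_distrib]
  have hQt : ∀ A ∈ Qt, ∀ B ∈ Qt, A ∪ B ∈ Qt := by
    intro A hA B hB
    rcases (mem_Qt A).1 hA with ⟨hAQ, hAW⟩ | ⟨T, hT, hVT, rfl⟩ <;>
      rcases (mem_Qt B).1 hB with ⟨hBQ, hBW⟩ | ⟨T', hT', hVT', rfl⟩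
    · exact (mem_Qt _).2 (Or.inl ⟨hQ A hAQ B hBQ, union_subset hAW hBW⟩)
    · rw [hφC A hAW T']
      exact (mem_Qt _).2 (Or.inr ⟨A ∪ T', hQ A hAQ T' hT', hVT'.trans subset_union_right, rfl⟩)
    · rw [union_comm, hφC B hBW T]
      exact (mem_Qt _).2 (Or.inr ⟨B ∪ T, hQ B hBQ T hT, hVT.trans subset_union_right, rfl⟩)
    · rw [hφφ T T']
      exact (mem_Qt _).2 (Or.inr ⟨T ∪ T', hQ T hT T' hT', hVT.trans subset_union_left, rfl⟩)
  have hφX : φ X = Xt := by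
    rw [hφdef]
    dsimp only
    rw [hVdef, sdiff_sdiff_right_self, inf_eq_inter, inter_eq_right.2 hWX]
  have hXtQt : Xt ∈ Qt := (mem_Qt _).2 (Or.inr ⟨X, hXQ, hVX, hφX⟩)
  -- `Z_{Q̃}(X̃) ≤ 0`
  have hZt : Z Qt (fun _ => 1) Xt ≤ 0 :=
    Z_nonpos (fun _ => 1) (fun _ => le_rfl) Xt.card Xt rfl ⟨x, mem_insert_self _ _⟩ Qt hQtX hQt hXtQt
  -- index sets of the two block expansions at `x`
  set I := ((X.powerset.filter fun T => x ∈ T ∧ T ∈ Q).erase X).filter fun T => V ⊆ T with hIdef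
  set I' := (Xt.powerset.filter fun T' => x ∈ T' ∧ T' ∈ Qt).erase Xt with hI'def
  have mem_I : ∀ T, T ∈ I ↔ T ⊆ X ∧ x ∈ T ∧ T ∈ Q ∧ T ≠ X ∧ V ⊆ T := by
    intro T
    rw [hIdef, mem_filter, mem_erase, mem_filter, mem_powerset]
    tauto
  -- cofactors `a_T = −Z_Q(X ∖ T) ≥ 0`
  have ha : ∀ T ∈ I, 0 ≤ -Z Q (fun _ => 1) (X \ T) := by
    intro T hT
    obtain ⟨hTX, -, -, hTne, -⟩ := (mem_I T).1 hT
    have hXT : (X \ T).Nonempty := sdiff_nonempty.2 fun h => hTne (subset_antisymm hTX h)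
    have := Z_nonpos_of_unionClosed hQ (b := fun _ => 1) (fun _ => le_rfl) hXT
    linarith
  -- (1) the expansion of `Z_Q(X)`: blocks not containing `V` contribute `0`
  have hexpQ : (((X.card - 1)! : ℕ) : ℤ) = ∑ T ∈ I, bw (fun _ => 1) T * (-Z Q (fun _ => 1) (X \ T)) := by
    have e := Z_rec_split Q (fun _ => 1) hx hXQ
    rw [hZ, bw_one] at e
    rw [hIdef, sum_filter]
    have hzero : ∀ T ∈ (X.powerset.filter fun T => x ∈ T ∧ T ∈ Q).erase X, ¬ V ⊆ T → Z Q (fun _ => 1) (X \ T) = 0 := by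
      intro T hT hVT
      rw [mem_erase, mem_filter, mem_powerset] at hT
      obtain ⟨hTne, hTX, hxT, hTQ⟩ := hT
      have hXT : (X \ T).Nonempty := sdiff_nonempty.2 fun h => hTne (subset_antisymm hTX h)
      refine Z_eq_zero_of_not_mem hQ _ hXT fun hXTQ => hVT ?_
      -- `X ∖ T ∈ Q` lies inside `M`, hence inside `W`, so `T ⊇ V`
      have hsub : X \ T ⊆ W := hCW _ hXTQ (sdiff_subset_sdiff subset_rfl (singleton_subset_iff.2 hxT))
      intro y hy
      rw [hVdef, mem_sdiff] at hy
      by_contra hyT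
      exact hy.2 (hsub (mem_sdiff.2 ⟨hy.1, hyT⟩))
    have hsum : ∑ T ∈ (X.powerset.filter fun T => x ∈ T ∧ T ∈ Q).erase X, (-bw (fun _ => 1) T) * Z Q (fun _ => 1) (X \ T) =
        ∑ T ∈ (X.powerset.filter fun T => x ∈ T ∧ T ∈ Q).erase X,
          if V ⊆ T then bw (fun _ => 1) T * (-Z Q (fun _ => 1) (X \ T)) else 0 := by
      refine sum_congr rfl fun T hT => ?_
      split_ifs with h
      · ring
      · rw [hzero T hT h, mul_zero]
    rw [hsum] at e
    linarith
  -- (2) the expansion of `Z_{Q̃}(X̃)`, re-indexed by `I` along `φ`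
  have hφ_sdiff : ∀ T ∈ I, Xt \ φ T = X \ T := by
    intro T hT
    obtain ⟨hTX, hxT, -, -, hVT⟩ := (mem_I T).1 hT
    ext y
    rw [mem_sdiff, mem_sdiff, hXtdef, mem_insert, hφdef]
    dsimp only
    rw [mem_insert, mem_sdiff, not_or, not_and, not_not]
    constructor
    · rintro ⟨hy | hy, hyx, hyT⟩
      · exact absurd hy hyx
      · exact ⟨hWX hy, fun h => (disjoint_left.1 hWV hy) (hyT h)⟩
    · rintro ⟨hyX, hyT⟩
      have hyV : y ∉ V := fun h => hyT (hVT h)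
      have hyW : y ∈ W := by by_contra h; exact hyV (mem_sdiff.2 ⟨hyX, h⟩)
      exact ⟨Or.inr hyW, fun h => hyT (h ▸ hxT), fun h => absurd h hyT⟩
  have hZres : ∀ C, C ⊆ W → Z Qt (fun _ => 1) C = Z Q (fun _ => 1) C := by
    intro C hCW
    rw [Z_restrict Qt, Z_restrict Q]
    congr 1
    ext A
    rw [mem_filter, mem_filter, mem_Qt]
    constructor
    · rintro ⟨⟨hAQ, -⟩ | ⟨T, -, -, rfl⟩, hAC⟩
      · exact ⟨hAQ, hAC⟩
      · exact absurd (hCW (hAC (mem_insert_self x _))) hxW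
    · rintro ⟨hAQ, hAC⟩
      exact ⟨Or.inl ⟨hAQ, hAC.trans hCW⟩, hAC⟩
  have hφcard : ∀ T ∈ I, (φ T).card = T.card - (V.card - 1) := by
    intro T hT
    obtain ⟨hTX, -, -, -, hVT⟩ := (mem_I T).1 hT
    have hxTV : x ∉ T \ V := fun h => (mem_sdiff.1 h).2 hxV
    rw [hφdef]
    dsimp only
    rw [card_insert_of_notMem hxTV, card_sdiff_of_subset hVT]
    have := card_le_card hVT
    omega
  have hexpQt : ∑ T ∈ I, bw (fun _ => 1) (φ T) * (-Z Q (fun _ => 1) (X \ T)) ≤ (((Xt.card - 1)! : ℕ) : ℤ) := by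
    have e := Z_rec_split Qt (fun _ => 1) (mem_insert_self x W) hXtQt
    rw [bw_one] at e
    -- re-index the erased sum along `φ : I → I'`
    have hreindex : ∑ T' ∈ I', (-bw (fun _ => 1) T') * Z Qt (fun _ => 1) (Xt \ T') =
        ∑ T ∈ I, (-bw (fun _ => 1) (φ T)) * Z Qt (fun _ => 1) (Xt \ φ T) := by
      symm
      refine sum_nbij' φ (fun T' => T' ∪ V) ?_ ?_ ?_ ?_ ?_
      · intro T hT
        obtain ⟨hTX, hxT, hTQ, hTne, hVT⟩ := (mem_I T).1 hT
        rw [hI'def, mem_erase, mem_filter, mem_powerset]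
        refine ⟨fun h => hTne ?_, hφXt T hTQ, mem_insert_self _ _, (mem_Qt _).2 (Or.inr ⟨T, hTQ, hVT, rfl⟩)⟩
        -- `φ T = X̃` forces `T = X`
        have h' : Xt \ φ T = X \ T := hφ_sdiff T hT
        rw [h, Finset.sdiff_self] at h'
        exact subset_antisymm hTX (Finset.sdiff_eq_empty_iff_subset.1 h'.symm)
      · intro T' hT'
        rw [hI'def, mem_erase, mem_filter, mem_powerset] at hT'
        obtain ⟨hT'ne, hT'Xt, hxT', hT'Qt⟩ := hT'
        rcases (mem_Qt T').1 hT'Qt with ⟨-, hT'W⟩ | ⟨T, hTQ, hVT, rfl⟩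
        · exact absurd (hT'W hxT') hxW
        · have hTX : T ⊆ X := mem_powerset.1 (hQX hTQ)
          have hT_eq : φ T ∪ V = T := by
            rw [hφdef]
            dsimp only
            rw [insert_union, sdiff_union_self_eq_union, union_eq_left.2 hVT, insert_eq_of_mem (hVT hxV)]
          rw [hT_eq, mem_I]
          refine ⟨hTX, hVT hxV, hTQ, fun h => hT'ne ?_, hVT⟩
          rw [h, hφX]
      · intro T hT
        obtain ⟨-, -, -, -, hVT⟩ := (mem_I T).1 hT
        change insert x (T \ V) ∪ V = T
        rw [insert_union, sdiff_union_self_eq_union, union_eq_left.2 hVT, insert_eq_of_mem (hVT hxV)]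
      · intro T' hT'
        rw [hI'def, mem_erase, mem_filter, mem_powerset] at hT'
        obtain ⟨-, hT'Xt, hxT', -⟩ := hT'
        change insert x ((T' ∪ V) \ V) = T'
        rw [union_sdiff_right]
        -- `T' ∖ V = T' ∖ {x}` since `T' ⊆ X̃` meets `V` only in `x`
        ext y
        rw [mem_insert, mem_sdiff]
        constructor
        · rintro (rfl | ⟨hy, -⟩)
          · exact hxT'
          · exact hy
        · intro hy
          by_cases hyx : y = x
          · exact Or.inl hyx
          · refine Or.inr ⟨hy, fun hyV => ?_⟩
            rcases mem_insert.1 (hT'Xt hy) with h | h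
            · exact hyx h
            · exact disjoint_left.1 hWV h hyV
      · intro T hT
        rfl
    rw [hreindex] at e
    have hsum : ∑ T ∈ I, (-bw (fun _ => 1) (φ T)) * Z Qt (fun _ => 1) (Xt \ φ T) =
        ∑ T ∈ I, bw (fun _ => 1) (φ T) * (-Z Q (fun _ => 1) (X \ T)) := by
      refine sum_congr rfl fun T hT => ?_
      obtain ⟨hTX, -, -, -, hVT⟩ := (mem_I T).1 hT
      have hXTW : X \ T ⊆ W := by
        rw [hXWV, union_sdiff_distrib, sdiff_eq_empty_iff_subset.2 hVT, union_empty]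
        exact sdiff_subset
      rw [hφ_sdiff T hT, hZres (X \ T) hXTW]
      ring
    rw [hsum] at e
    linarith
  -- (3) the comparison
  set d := V.card - 1 with hddef
  have hd : 1 ≤ d := by omega
  have hkd : Xt.card = X.card - d := by omega
  have hcoef : ∀ T ∈ I, bw (fun _ => 1) T * (((Xt.card - 1)! : ℕ) : ℤ) + 1 ≤ (((X.card - 1)! : ℕ) : ℤ) * bw (fun _ => 1) (φ T) := by
    intro T hT
    obtain ⟨hTX, hxT, -, hTne, hVT⟩ := (mem_I T).1 hT
    rw [bw_one, bw_one, hφcard T hT, hkd]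
    have hmk : T.card < X.card := card_lt_card (Finset.ssubset_iff_subset_ne.2 ⟨hTX, hTne⟩)
    have hdm : d + 1 ≤ T.card := by have := card_le_card hVT; omega
    have h := factorial_mul_factorial_lt hd hdm hmk
    have h' : (((T.card - 1)! : ℕ) : ℤ) * (((X.card - d - 1)! : ℕ) : ℤ) < (((X.card - 1)! : ℕ) : ℤ) * (((T.card - d - 1)! : ℕ) : ℤ) := by
      exact_mod_cast h
    linarith
  have hsum_a : ∑ T ∈ I, (-Z Q (fun _ => 1) (X \ T)) ≤ 0 := by
    have h1 : ∑ T ∈ I, (-Z Q (fun _ => 1) (X \ T)) ≤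
        ∑ T ∈ I, ((((X.card - 1)! : ℕ) : ℤ) * bw (fun _ => 1) (φ T) - bw (fun _ => 1) T * (((Xt.card - 1)! : ℕ) : ℤ)) *
          (-Z Q (fun _ => 1) (X \ T)) :=
      sum_le_sum fun T hT => by nlinarith [hcoef T hT, ha T hT]
    have h2 : ∑ T ∈ I, ((((X.card - 1)! : ℕ) : ℤ) * bw (fun _ => 1) (φ T) - bw (fun _ => 1) T * (((Xt.card - 1)! : ℕ) : ℤ)) *
          (-Z Q (fun _ => 1) (X \ T)) =
        (((X.card - 1)! : ℕ) : ℤ) * ∑ T ∈ I, bw (fun _ => 1) (φ T) * (-Z Q (fun _ => 1) (X \ T)) -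
          (((Xt.card - 1)! : ℕ) : ℤ) * ∑ T ∈ I, bw (fun _ => 1) T * (-Z Q (fun _ => 1) (X \ T)) := by
      rw [mul_sum, mul_sum, ← sum_sub_distrib]
      refine sum_congr rfl fun T _ => by ring
    rw [h2, ← hexpQ] at h1
    have h3 : (0 : ℤ) ≤ (((X.card - 1)! : ℕ) : ℤ) := by positivity
    nlinarith [hexpQt]
  have hall : ∀ T ∈ I, -Z Q (fun _ => 1) (X \ T) = 0 := fun T hT =>
    le_antisymm (by have := (sum_eq_zero_iff_of_nonneg ha).1 (le_antisymm hsum_a (sum_nonneg ha)) T hT; rw [this]) (ha T hT)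
  have hzero : (((X.card - 1)! : ℕ) : ℤ) = 0 := by
    rw [hexpQ]
    exact sum_eq_zero fun T hT => by rw [hall T hT, mul_zero]
  exact absurd hzero (by exact_mod_cast (Nat.factorial_pos _).ne')

/-- The coatom lemma, `N` form: `N_Q(𝟙; X) = 0 ⟹ X ∖ {x} ∈ Q`. [this work] -/
theorem sdiff_singleton_mem_of_N_eq_zero {Q : Finset (Finset α)} {X : Finset α} (hQ : ∀ A ∈ Q, ∀ B ∈ Q, A ∪ B ∈ Q)
    (hQX : Q ⊆ X.powerset) (hXQ : X ∈ Q) (hcard : 2 ≤ X.card)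
    (hN : N Q (fun _ => 1) X = 0) {x : α} (hx : x ∈ X) : X \ {x} ∈ Q := by
  rw [N_eq_neg_Z, neg_eq_zero] at hN
  exact sdiff_singleton_mem_of_Z_eq_zero hQ hQX hXQ hcard hN hx

end SahiSparseEnd

end Summit.CriticalPhenomena.PercolationContinuityZ3.Theorems
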